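import Summits.Parity.BatemanHorn.Theorems.SoloInformedLocatedRootCountEquivalence
import Summits.Parity.BatemanHorn.Theorems.SoloInformedPolynomialGrowth

/-!
# The divisor-pairing storey for EVERY irreducible polynomial of degree `≥ 2` — no growth hypotheses

Solo informed line (Parity / Bateman–Horn), session 136.  `SoloInformedDivisorPairingStorey`,
`SoloInformedRootCountLevel`, `SoloInformedQuadraticDivisorSum` and `SoloInformedLocatedRootCountEquivalence` carry the
pointwise hypothesis `n² ≤ |g(n)|` (and, on the quadratic side, `|g(n)| ≤ (Bn)²`) for ALL `n ≥ 1`, which e.g. `n² − 2n + 3`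
violates at `n = 1`.  This file removes them:

* the storey inequality under the WEAK hypothesis `n² ≤ B·|g(n)|` (`abs_polyDivisorSum_sub_main_sub_located_le_gen`:
  `|S_g(x) − 2x L_g(x) − 2 Mid_g(x)| ≤ x + (2B+4) ∑_{d≤x} ρ_g(d)`; the boundary term is `≤ (B+1)∑ρ_g(d)` because
  `|g(n)| ≤ d²` now only forces `n ≤ Bd`);
* every irreducible `g` of degree `≥ 2` has no natural root (`SoloInformedPolynomialGrowth.eval_natCast_ne_zero_of_irreducible`) and satisfies
  `n² ≤ B·|g(n)|` for some `B ≥ 1` and all `n ≥ 1` (`exists_sq_le_mul_natAbs_eval`, from Mathlib's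
  `Polynomial.isEquivalent_atTop_lead`); a polynomial of degree `≤ 2` satisfies `|g(n)| ≤ (Bn)²` (`exists_natAbs_eval_le_sq`);
* hence, with NO hypothesis beyond irreducibility and the degree:
  `exists_abs_polyDivisorSum_sub_located_sub_log_le_of_two_le` — `|S_g(x) − 2Mid_g(x) − 2A_g x log x| ≤ Cx` for every
  irreducible `g` with `deg g ≥ 2`; `tendsto_polyDivisorSum_div_iff_of_two_le` — `S_g/(x log x) → c ⟺ Mid_g/(x log x) → (c−2A_g)/2`;
  `exists_abs_polyDivisorSum_sub_log_le_of_natDegree_eq_two` — `|S_g(x) − 2A_g x log x| ≤ Cx` for EVERY irreducible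
  quadratic `g`; `tendsto_polyDivisorSum_quadratic_div` — `S_g(x)/(x log x) → 2A_g`.
-/

open Finset Real Polynomial Filter Topology Asymptotics

namespace Summit.Parity.BatemanHorn.Theorems

open Literature.NumberTheory.Sieve (polyRootCountMod exists_sum_rootCount_le)

/-! ## A. The storey inequality under `n² ≤ B |g(n)|` -/

/-- **Boundary term, weak hypothesis**: if `n² ≤ B|g(n)|` on `[1, x]` (`B ≥ 1`) then
`Bdry_g(x) ≤ (B+1) ∑_{d ≤ x} ρ_g(d)`: `|g(n)| ≤ d²` forces `n ≤ Bd`, and `#{n ≤ Bd : d ∣ g(n)} ≤ (B+1)ρ_g(d)`. -/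
theorem polyBdryCount_le_gen (g : ℤ[X]) {B x : ℕ} (hB : 1 ≤ B)
    (hsq : ∀ n ∈ Icc 1 x, n * n ≤ B * (g.eval (n : ℤ)).natAbs) :
    (polyBdryCount g x : ℝ) ≤ ((B : ℝ) + 1) * ∑ d ∈ Icc 1 x, (polyRootCountMod ![g] d : ℝ) := by
  have hstep : polyBdryCount g x
      ≤ ∑ d ∈ Icc 1 x, #((Icc 1 (B * d)).filter fun n : ℕ => (d : ℤ) ∣ g.eval (n : ℤ)) := by
    unfold polyBdryCount
    have h1 : ∀ n ∈ Icc 1 x,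
        #(((g.eval (n : ℤ)).natAbs.divisors).filter fun d => d ≤ x ∧ (g.eval (n : ℤ)).natAbs ≤ d * d)
          ≤ ∑ d ∈ Icc 1 x, if (n ≤ B * d ∧ (d : ℤ) ∣ g.eval (n : ℤ)) then 1 else 0 := by
      intro n hn
      rw [← card_filter]
      refine card_le_card_of_injOn (fun d => d) (fun d hd => ?_) (Set.injOn_id _)
      simp only [coe_filter, Nat.mem_divisors, mem_Icc, Set.mem_setOf_eq] at hd ⊢
      obtain ⟨⟨hdN, hN⟩, hdx, hNd⟩ := hd
      refine ⟨⟨Nat.pos_of_dvd_of_pos hdN (Nat.pos_of_ne_zero hN), hdx⟩, ?_, Int.natCast_dvd.mpr hdN⟩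
      have h2 : n * n ≤ (B * d) * (B * d) :=
        calc n * n ≤ B * (g.eval (n : ℤ)).natAbs := hsq n hn
          _ ≤ B * (d * d) := Nat.mul_le_mul_left _ hNd
          _ ≤ (B * d) * (B * d) := by nlinarith
      exact Nat.mul_self_le_mul_self_iff.mp h2
    refine (sum_le_sum h1).trans ?_
    rw [sum_comm]
    refine sum_le_sum fun d _ => ?_
    rw [← card_filter]
    refine card_le_card_of_injOn (fun n => n) (fun n hn => ?_) (Set.injOn_id _)
    simp only [coe_filter, mem_Icc, Set.mem_setOf_eq] at hn ⊢
    exact ⟨⟨hn.1.1, hn.2.1⟩, hn.2.2⟩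
  calc (polyBdryCount g x : ℝ)
      ≤ ∑ d ∈ Icc 1 x, (#((Icc 1 (B * d)).filter fun n : ℕ => (d : ℤ) ∣ g.eval (n : ℤ)) : ℝ) := by
        exact_mod_cast hstep
    _ ≤ ∑ d ∈ Icc 1 x, ((B : ℝ) + 1) * (polyRootCountMod ![g] d : ℝ) := by
        refine sum_le_sum fun d hd => ?_
        have hd0 : 0 < d := (mem_Icc.mp hd).1
        have hd0' : (d : ℝ) ≠ 0 := by exact_mod_cast hd0.ne'
        have h := abs_card_filter_dvd_eval_sub_le g hd0 (B * d)
        have hdd : ((B * d : ℕ) : ℝ) * (polyRootCountMod ![g] d : ℝ) / d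
            = (B : ℝ) * polyRootCountMod ![g] d := by
          rw [Nat.cast_mul, mul_right_comm, mul_div_assoc, div_self hd0', mul_one]
        rw [hdd] at h
        have := (abs_sub_le_iff.mp h).1
        linarith
    _ = ((B : ℝ) + 1) * ∑ d ∈ Icc 1 x, (polyRootCountMod ![g] d : ℝ) := by rw [mul_sum]

/-- **Storey inequality, weak hypothesis**: `|S_g(x) − 2x·L_g(x) − 2·Mid_g(x)| ≤ x + (2B+4)∑_{d≤x} ρ_g(d)` whenever
`n² ≤ B|g(n)|` on `[1, x]`. -/
theorem abs_polyDivisorSum_sub_main_sub_located_le_gen (g : ℤ[X]) {B x : ℕ} (hB : 1 ≤ B)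
    (hsq : ∀ n ∈ Icc 1 x, n * n ≤ B * (g.eval (n : ℤ)).natAbs) :
    |(polyDivisorSum g x : ℝ) - 2 * (x : ℝ) * polySmallLevel g x - 2 * (polyLocatedRootCount g x : ℝ)|
      ≤ (x : ℝ) + (2 * (B : ℝ) + 4) * ∑ d ∈ Icc 1 x, (polyRootCountMod ![g] d : ℝ) := by
  have hg0 : ∀ n ∈ Icc 1 x, g.eval (n : ℤ) ≠ 0 := by
    intro n hn h
    have := hsq n hn
    rw [h, Int.natAbs_zero, mul_zero] at this
    have h1 : 1 ≤ n := (mem_Icc.mp hn).1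
    nlinarith
  have hdec := polyDivisorSum_add_two_mul_bdry_eq g x
  have hdecR : (polyDivisorSum g x : ℝ) + 2 * (polyBdryCount g x : ℝ)
      = 2 * (polySmallStorey g x : ℝ) + 2 * (polyLocatedRootCount g x : ℝ) + (polySqCount g x : ℝ) := by
    exact_mod_cast hdec
  have hA := abs_polySmallStorey_sub_le g hg0
  have hBd := polyBdryCount_le_gen g hB hsq
  have hB0 : (0 : ℝ) ≤ polyBdryCount g x := Nat.cast_nonneg _
  have hSq : (polySqCount g x : ℝ) ≤ x := by exact_mod_cast polySqCount_le g x
  have hSq0 : (0 : ℝ) ≤ polySqCount g x := Nat.cast_nonneg _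
  have hs0 : (0 : ℝ) ≤ ∑ d ∈ Icc 1 x, (polyRootCountMod ![g] d : ℝ) :=
    sum_nonneg fun _ _ => Nat.cast_nonneg _
  have hBR : (1 : ℝ) ≤ B := by exact_mod_cast hB
  set s := ∑ d ∈ Icc 1 x, (polyRootCountMod ![g] d : ℝ) with hs
  have hBs : 0 ≤ (B : ℝ) * s := mul_nonneg (by linarith) hs0
  rw [abs_le] at hA ⊢
  constructor <;> nlinarith [hA.1, hA.2]

/-- **Headline, weak hypothesis**: for `g` irreducible of positive degree with `n² ≤ B|g(n)|` for all `n ≥ 1`,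
`|S_g(x) − 2x L_g(x) − 2 Mid_g(x)| ≤ Cx` for `x ≥ 2`. -/
theorem exists_abs_polyDivisorSum_sub_le_gen {g : ℤ[X]} (hirr : Irreducible g) (hdeg : 0 < g.natDegree)
    {B : ℕ} (hB : 1 ≤ B) (hsq : ∀ n : ℕ, 1 ≤ n → n * n ≤ B * (g.eval (n : ℤ)).natAbs) :
    ∃ C : ℝ, ∀ x : ℕ, 2 ≤ x →
      |(polyDivisorSum g x : ℝ) - 2 * (x : ℝ) * polySmallLevel g x - 2 * (polyLocatedRootCount g x : ℝ)|
        ≤ C * x := by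
  obtain ⟨C, hC0, hC⟩ := exists_sum_rootCount_le hirr hdeg
  refine ⟨1 + (2 * B + 4) * C, fun x hx => ?_⟩
  have h1 := abs_polyDivisorSum_sub_main_sub_located_le_gen g (x := x) hB
    fun n hn => hsq n (mem_Icc.mp hn).1
  have h2 := hC (x : ℝ) (by exact_mod_cast hx)
  rw [Nat.floor_natCast] at h2
  have hB0 : (0 : ℝ) ≤ 2 * (B : ℝ) + 4 := by positivity
  have h3 : (2 * (B : ℝ) + 4) * ∑ d ∈ Icc 1 x, (polyRootCountMod ![g] d : ℝ) ≤ (2 * (B : ℝ) + 4) * (C * x) :=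
    mul_le_mul_of_nonneg_left h2 hB0
  linarith

/-- **Unconditional located form, weak hypothesis**: `|S_g(x) − 2Mid_g(x) − 2A_g x log x| ≤ Cx`, `x ≥ 2`,
`A_g = rootLevelConst g` (Dedekind–Landau mean value from `SoloInformedRootCountLevel`). -/
theorem exists_abs_polyDivisorSum_sub_located_sub_log_le_gen {g : ℤ[X]} (hirr : Irreducible g)
    (hdeg : 0 < g.natDegree) {B : ℕ} (hB : 1 ≤ B)
    (hsq : ∀ n : ℕ, 1 ≤ n → n * n ≤ B * (g.eval (n : ℤ)).natAbs) :
    ∃ C : ℝ, ∀ x : ℕ, 2 ≤ x →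
      |(polyDivisorSum g x : ℝ) - 2 * (polyLocatedRootCount g x : ℝ) -
          2 * rootLevelConst g * (x : ℝ) * Real.log x| ≤ C * x := by
  obtain ⟨C, hC⟩ := exists_abs_polyDivisorSum_sub_le_gen hirr hdeg hB hsq
  obtain ⟨K, hK⟩ := exists_abs_polySmallLevel_sub_log_le hirr hdeg
  refine ⟨C + 2 * K, fun x hx => ?_⟩
  have h1 := hC x hx
  have h2 := hK x (by omega)
  have hx0 : (0 : ℝ) ≤ x := Nat.cast_nonneg _
  rw [abs_le] at h1 h2 ⊢
  constructor <;> nlinarith [h1.1, h1.2, h2.1, h2.2]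

/-! ## B. Growth of irreducible polynomials of degree `≥ 2` at natural arguments -/

/-- `((g(n)).natAbs : ℝ) = |(g(n) : ℝ)|`. -/
theorem natCast_natAbs_eval (g : ℤ[X]) (n : ℕ) :
    (((g.eval (n : ℤ) : ℤ).natAbs : ℕ) : ℝ) = |((g.eval (n : ℤ) : ℤ) : ℝ)| := by
  rw [← Int.cast_abs, ← Int.natCast_natAbs, Int.cast_natCast]

/-- **Lower growth**: if `deg g ≥ 2` and `g(n) ≠ 0` for all `n ≥ 1`, there is `B ≥ 1` with `n² ≤ B·|g(n)|` for all `n ≥ 1`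
(eventually `|g(x)| ≥ x^{deg g}/c ≥ x²/c` by `Polynomial.isEquivalent_atTop_lead`; the finitely many small `n` are
absorbed using `|g(n)| ≥ 1`). -/
theorem exists_sq_le_mul_natAbs_eval {g : ℤ[X]} (hdeg : 2 ≤ g.natDegree)
    (hz : ∀ n : ℕ, 1 ≤ n → g.eval (n : ℤ) ≠ 0) :
    ∃ B : ℕ, 1 ≤ B ∧ ∀ n : ℕ, 1 ≤ n → n * n ≤ B * (g.eval (n : ℤ)).natAbs := by
  set P : ℝ[X] := g.map (Int.castRingHom ℝ) with hP
  have hinj : Function.Injective (Int.castRingHom ℝ) := Int.cast_injective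
  have hPdeg : P.natDegree = g.natDegree := natDegree_map_eq_of_injective hinj g
  have hlead : P.leadingCoeff = ((g.leadingCoeff : ℤ) : ℝ) := by
    rw [hP, leadingCoeff_map_of_injective hinj]; rfl
  have hg0 : g ≠ 0 := by rintro rfl; simp at hdeg
  have hlc1 : (1 : ℝ) ≤ |P.leadingCoeff| := by
    rw [hlead, ← Int.cast_abs]
    exact_mod_cast Int.one_le_abs (leadingCoeff_ne_zero.mpr hg0)
  have hequiv := Polynomial.isEquivalent_atTop_lead P
  obtain ⟨c, hc0, hcw⟩ := hequiv.isBigO_symm.exists_pos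
  obtain ⟨a, ha⟩ := Filter.eventually_atTop.mp hcw.bound
  set N₀ : ℕ := ⌈max a 1⌉₊ with hN₀
  refine ⟨max ⌈c⌉₊ (N₀ * N₀) + 1, by omega, fun n hn => ?_⟩
  set Bn : ℕ := max ⌈c⌉₊ (N₀ * N₀) + 1 with hBn
  have hz' : 1 ≤ (g.eval (n : ℤ)).natAbs :=
    Nat.one_le_iff_ne_zero.mpr (Int.natAbs_ne_zero.mpr (hz n hn))
  by_cases hnN : N₀ ≤ n
  · -- large `n`: use the asymptotic bound
    have hna : a ≤ (n : ℝ) := by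
      have h1 : a ≤ max a 1 := le_max_left _ _
      have h2 : max a 1 ≤ (N₀ : ℝ) := Nat.le_ceil _
      have h3 : (N₀ : ℝ) ≤ n := by exact_mod_cast hnN
      linarith
    have h1 := ha (n : ℝ) hna
    -- `h1 : ‖P.leadingCoeff * n ^ P.natDegree‖ ≤ c * ‖P.eval n‖`
    rw [Real.norm_eq_abs, Real.norm_eq_abs, abs_mul, hPdeg, eval_natCast_map_intCast,
      ← natCast_natAbs_eval] at h1
    have hn1 : (1 : ℝ) ≤ n := by exact_mod_cast hn
    have hpow : (n : ℝ) ^ 2 ≤ (n : ℝ) ^ g.natDegree := pow_le_pow_right₀ hn1 hdeg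
    have habs : |(n : ℝ) ^ g.natDegree| = (n : ℝ) ^ g.natDegree := abs_of_nonneg (by positivity)
    rw [habs] at h1
    have hpos : (0 : ℝ) ≤ (n : ℝ) ^ g.natDegree := by positivity
    have key : (n : ℝ) ^ 2 ≤ c * (((g.eval (n : ℤ)).natAbs : ℕ) : ℝ) := by
      calc (n : ℝ) ^ 2 ≤ (n : ℝ) ^ g.natDegree := hpow
        _ ≤ |P.leadingCoeff| * (n : ℝ) ^ g.natDegree := le_mul_of_one_le_left hpos hlc1
        _ ≤ c * (((g.eval (n : ℤ)).natAbs : ℕ) : ℝ) := h1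
    have hcB : c ≤ (Bn : ℝ) := by
      have h2 : c ≤ (⌈c⌉₊ : ℝ) := Nat.le_ceil c
      have h3 : (⌈c⌉₊ : ℝ) ≤ ((max ⌈c⌉₊ (N₀ * N₀) : ℕ) : ℝ) := by exact_mod_cast le_max_left _ _
      rw [hBn, Nat.cast_add_one]
      linarith
    have hρ0 : (0 : ℝ) ≤ (((g.eval (n : ℤ)).natAbs : ℕ) : ℝ) := Nat.cast_nonneg _
    have hfin : ((n * n : ℕ) : ℝ) ≤ ((Bn * (g.eval (n : ℤ)).natAbs : ℕ) : ℝ) := by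
      push_cast
      nlinarith [mul_le_mul_of_nonneg_right hcB hρ0]
    exact_mod_cast hfin
  · -- small `n`: `n² ≤ N₀² ≤ Bn ≤ Bn·|g(n)|`
    have hlt : n < N₀ := Nat.lt_of_not_le hnN
    calc n * n ≤ N₀ * N₀ := Nat.mul_le_mul hlt.le hlt.le
      _ ≤ Bn := by rw [hBn]; omega
      _ ≤ Bn * (g.eval (n : ℤ)).natAbs := Nat.le_mul_of_pos_right _ hz'

/-- **Upper growth for degree `≤ 2`**: `|g(n)| ≤ (Bn)²` for all `n ≥ 1`, with `B = |a₀| + |a₁| + |a₂| + 1`. -/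
theorem exists_natAbs_eval_le_sq {g : ℤ[X]} (hdeg : g.natDegree ≤ 2) :
    ∃ B : ℕ, 1 ≤ B ∧ ∀ n : ℕ, 1 ≤ n → (g.eval (n : ℤ)).natAbs ≤ (B * n) * (B * n) := by
  set M : ℕ := (g.coeff 0).natAbs + (g.coeff 1).natAbs + (g.coeff 2).natAbs + 1 with hM
  refine ⟨M, by omega, fun n hn => ?_⟩
  have heval : g.eval (n : ℤ) = g.coeff 0 + g.coeff 1 * n + g.coeff 2 * (n : ℤ) ^ 2 := by
    have hg := as_sum_range' g 3 (by omega)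
    conv_lhs => rw [hg]
    simp [Finset.sum_range_succ]
    try ring
  have hn1 : (1 : ℤ) ≤ n := by exact_mod_cast hn
  have hMZ : (M : ℤ) = |g.coeff 0| + |g.coeff 1| + |g.coeff 2| + 1 := by
    simp only [hM, Nat.cast_add, Nat.cast_one, Int.natCast_natAbs]
  have h0 := abs_nonneg (g.coeff 0)
  have h1 := abs_nonneg (g.coeff 1)
  have h2 := abs_nonneg (g.coeff 2)
  have hbound : |g.eval (n : ℤ)| ≤ (M : ℤ) * n * ((M : ℤ) * n) := by
    rw [heval]
    have t1 : |g.coeff 0 + g.coeff 1 * n + g.coeff 2 * (n : ℤ) ^ 2|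
        ≤ |g.coeff 0| + |g.coeff 1| * n + |g.coeff 2| * (n : ℤ) ^ 2 := by
      have e1 := abs_add_le (g.coeff 0 + g.coeff 1 * n) (g.coeff 2 * (n : ℤ) ^ 2)
      have e2 := abs_add_le (g.coeff 0) (g.coeff 1 * n)
      rw [abs_mul, abs_of_nonneg (by positivity : (0 : ℤ) ≤ n)] at e2
      rw [abs_mul, abs_of_nonneg (by positivity : (0 : ℤ) ≤ (n : ℤ) ^ 2)] at e1
      linarith
    have hn2 : (n : ℤ) ≤ (n : ℤ) ^ 2 := by nlinarith
    have hn3 : (1 : ℤ) ≤ (n : ℤ) ^ 2 := by nlinarith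
    have t2 : |g.coeff 0| + |g.coeff 1| * n + |g.coeff 2| * (n : ℤ) ^ 2
        ≤ (|g.coeff 0| + |g.coeff 1| + |g.coeff 2| + 1) * (n : ℤ) ^ 2 := by
      nlinarith [mul_le_mul_of_nonneg_left hn3 h0, mul_le_mul_of_nonneg_left hn2 h1, sq_nonneg (n : ℤ)]
    have t3 : (|g.coeff 0| + |g.coeff 1| + |g.coeff 2| + 1) * (n : ℤ) ^ 2 ≤ (M : ℤ) * n * ((M : ℤ) * n) := by
      rw [hMZ]
      set S1 : ℤ := |g.coeff 0| + |g.coeff 1| + |g.coeff 2| + 1 with hS1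
      have hM1 : (1 : ℤ) ≤ S1 := by rw [hS1]; linarith
      have hsq1 : S1 ≤ S1 * S1 := le_mul_of_one_le_left (by linarith) hM1
      nlinarith [mul_le_mul_of_nonneg_right hsq1 (sq_nonneg (n : ℤ))]
    linarith
  have hfin : (((g.eval (n : ℤ)).natAbs : ℕ) : ℤ) ≤ (((M * n) * (M * n) : ℕ) : ℤ) := by
    rw [Int.natCast_natAbs]; push_cast; exact hbound
  exact_mod_cast hfin

/-! ## C. The storey theorems with no growth hypotheses -/

/-- **Every irreducible `g` of degree `≥ 2`**: `|∑_{n≤x} τ(|g(n)|) − 2·Mid_g(x) − 2A_g·x log x| ≤ Cx` for `x ≥ 2` —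
the divisor sum along `g` IS twice the located root count plus the explicit main term, up to `O(x)`. [this work] -/
theorem exists_abs_polyDivisorSum_sub_located_sub_log_le_of_two_le {g : ℤ[X]} (hirr : Irreducible g)
    (hdeg : 2 ≤ g.natDegree) :
    ∃ C : ℝ, ∀ x : ℕ, 2 ≤ x →
      |(polyDivisorSum g x : ℝ) - 2 * (polyLocatedRootCount g x : ℝ) -
          2 * rootLevelConst g * (x : ℝ) * Real.log x| ≤ C * x := by
  obtain ⟨B, hB, hsq⟩ := exists_sq_le_mul_natAbs_eval hdeg
    fun n _ => eval_natCast_ne_zero_of_irreducible hirr hdeg n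
  exact exists_abs_polyDivisorSum_sub_located_sub_log_le_gen hirr (by omega) hB hsq

/-- Division by `x log x`: an `O(x)` identity between `S`, `M` and `A x log x` gives the equivalence of the limits. -/
theorem tendsto_div_iff_of_abs_sub_le {S M : ℕ → ℝ} {A C : ℝ}
    (h : ∀ x : ℕ, 2 ≤ x → |S x - 2 * M x - 2 * A * (x : ℝ) * Real.log x| ≤ C * x) (c : ℝ) :
    Tendsto (fun x : ℕ => S x / ((x : ℝ) * Real.log x)) atTop (𝓝 c) ↔
      Tendsto (fun x : ℕ => M x / ((x : ℝ) * Real.log x)) atTop (𝓝 ((c - 2 * A) / 2)) := by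
  set S' : ℕ → ℝ := fun x => S x / ((x : ℝ) * Real.log x) with hS'
  set M' : ℕ → ℝ := fun x => M x / ((x : ℝ) * Real.log x) with hM'
  have hE : Tendsto (fun x : ℕ => S' x - 2 * M' x - 2 * A) atTop (𝓝 0) := by
    have h0 := tendsto_div_mul_log_of_abs_le h
    refine h0.congr' ?_
    filter_upwards [eventually_ge_atTop 2] with x hx
    have hx' : (2 : ℝ) ≤ x := by exact_mod_cast hx
    have hlogpos : 0 < Real.log (x : ℝ) := Real.log_pos (by linarith)
    have hne : (x : ℝ) * Real.log x ≠ 0 := by positivity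
    simp only [hS', hM']
    field_simp
  constructor
  · intro hSc
    have h1 : Tendsto (fun x => (S' x - (S' x - 2 * M' x - 2 * A) - 2 * A) / 2) atTop
        (𝓝 ((c - 0 - 2 * A) / 2)) := ((hSc.sub hE).sub tendsto_const_nhds).div_const 2
    have h2 := h1.congr (f₂ := M') (fun x => by ring)
    convert h2 using 2
    ring
  · intro hMc
    have h1 : Tendsto (fun x => (S' x - 2 * M' x - 2 * A) + 2 * M' x + 2 * A) atTop
        (𝓝 (0 + 2 * ((c - 2 * A) / 2) + 2 * A)) := (hE.add (hMc.const_mul 2)).add tendsto_const_nhds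
    have h2 := h1.congr (f₂ := S') (fun x => by ring)
    convert h2 using 2
    ring

/-- **Erdős ⟺ located root count, every irreducible `g` of degree `≥ 2`**: for every real `c`,
`∑_{n≤x} τ(|g(n)|)/(x log x) → c` iff `Mid_g(x)/(x log x) → (c − 2A_g)/2`. [this work] -/
theorem tendsto_polyDivisorSum_div_iff_of_two_le {g : ℤ[X]} (hirr : Irreducible g) (hdeg : 2 ≤ g.natDegree)
    (c : ℝ) :
    Tendsto (fun x : ℕ => (polyDivisorSum g x : ℝ) / ((x : ℝ) * Real.log x)) atTop (𝓝 c) ↔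
      Tendsto (fun x : ℕ => (polyLocatedRootCount g x : ℝ) / ((x : ℝ) * Real.log x)) atTop
        (𝓝 ((c - 2 * rootLevelConst g) / 2)) := by
  obtain ⟨C, hC⟩ := exists_abs_polyDivisorSum_sub_located_sub_log_le_of_two_le hirr hdeg
  exact tendsto_div_iff_of_abs_sub_le hC c

/-- **Every irreducible quadratic**: `|∑_{n≤x} τ(|g(n)|) − 2A_g·x log x| ≤ Cx` for `x ≥ 2` — the located root count
of a quadratic is `O(x)` (`SoloInformedQuadraticDivisorSum.exists_polyLocatedRootCount_le`, window of bounded width). [this work] -/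
theorem exists_abs_polyDivisorSum_sub_log_le_of_natDegree_eq_two {g : ℤ[X]} (hirr : Irreducible g)
    (hdeg : g.natDegree = 2) :
    ∃ C : ℝ, ∀ x : ℕ, 2 ≤ x →
      |(polyDivisorSum g x : ℝ) - 2 * rootLevelConst g * (x : ℝ) * Real.log x| ≤ C * x := by
  obtain ⟨C₁, hC₁⟩ := exists_abs_polyDivisorSum_sub_located_sub_log_le_of_two_le hirr (by omega)
  obtain ⟨B, hB, hgr⟩ := exists_natAbs_eval_le_sq (g := g) (by omega)
  obtain ⟨C₂, hC₂⟩ := exists_polyLocatedRootCount_le hirr (by omega) hB hgr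
  refine ⟨C₁ + 2 * C₂, fun x hx => ?_⟩
  have h1 := hC₁ x hx
  have h2 := hC₂ x hx
  have h0 : (0 : ℝ) ≤ polyLocatedRootCount g x := Nat.cast_nonneg _
  rw [abs_le] at h1 ⊢
  constructor <;> nlinarith [h1.1, h1.2]

/-- **Every irreducible quadratic, limit form**: `∑_{n≤x} τ(|g(n)|)/(x log x) → 2A_g`. [this work] -/
theorem tendsto_polyDivisorSum_quadratic_div {g : ℤ[X]} (hirr : Irreducible g) (hdeg : g.natDegree = 2) :
    Tendsto (fun x : ℕ => (polyDivisorSum g x : ℝ) / ((x : ℝ) * Real.log x)) atTop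
      (𝓝 (2 * rootLevelConst g)) := by
  obtain ⟨C, hC⟩ := exists_abs_polyDivisorSum_sub_log_le_of_natDegree_eq_two hirr hdeg
  set A := rootLevelConst g with hA
  set S : ℕ → ℝ := fun x => (polyDivisorSum g x : ℝ) / ((x : ℝ) * Real.log x) with hS
  have hE : Tendsto (fun x : ℕ => S x - 2 * A) atTop (𝓝 0) := by
    have h0 := tendsto_div_mul_log_of_abs_le hC
    refine h0.congr' ?_
    filter_upwards [eventually_ge_atTop 2] with x hx
    have hx' : (2 : ℝ) ≤ x := by exact_mod_cast hx
    have hlogpos : 0 < Real.log (x : ℝ) := Real.log_pos (by linarith)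
    have hne : (x : ℝ) * Real.log x ≠ 0 := by positivity
    simp only [hS]
    field_simp
  have h : Tendsto (fun x => (S x - 2 * A) + 2 * A) atTop (𝓝 (0 + 2 * A)) := hE.add tendsto_const_nhds
  have h2 := h.congr (f₂ := S) (fun x => by ring)
  simpa using h2

end Summit.Parity.BatemanHorn.Theorems
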